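import Mathlib
import Summits.Ventures.PercRepro2.Sep2OShield

/-!
# THE UNIFIED o-SHIELD, the sums: `btw(x; o, b) = 0` for `K = {x, a₁}` separating `o` from `{b, a₂}`
(blind cell PercRepro2, night-1 g33; proofs/NIGHT1-G33.md §8; census 152/152)

Setting of Sep2OShield.  The fibre sums split into the three root classes (`sum_split`); the class sums
are probabilities of `Q ∩ Z ∩ G_c` (`sum_F2`, `sum_F3`, via the filter partition
`MarkPull.sum_filter_fibre_inter`), and the `γ`-identity kills every class sum of
`σ_b (F⁰_o − γ m_W) / m_W` and of `F⁰_o − γ m_W`: `sum_term_eq`, `sum_SFg_eq`, `sum_termA_eq`,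
`sum_SuA_o_eq`.  Hence **`btw_sep2_o : btw p ends o a₁ a₂ x b = 0`** (for `D ≠ 0`),
**`A3Between_sep2_o`** and **`HCov_sep2_o`** unconditionally.  Standard axioms.
-/

namespace Summit.Ventures.PercRepro2

open UnionCluster CovForm CutV Sep2

namespace CovForm

namespace A3Fibre

namespace Sep2Shield

section Sums

variable {V : Type*} {E : Type*} [Fintype V] [DecidableEq V] [Fintype E] [DecidableEq E]
  {R : Type*} [Field R] [LinearOrder R] [IsStrictOrderedRing R] {ends : E → Sym2 V} {x a₁ : V}
  {VA VB : Finset V} {EA EB : Set E} [DecidablePred (· ∈ EA)] [DecidablePred (· ∈ EB)] {p : E → R}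
  {o a₂ b : V}

omit [Fintype E] [DecidableEq E] [Field R] [LinearOrder R] [IsStrictOrderedRing R]
  [DecidablePred (· ∈ EA)] [DecidablePred (· ∈ EB)] in
/-- The three root classes of the fibres. -/
lemma sum_split {S : Type*} [AddCommMonoid S] (g : Finset V → S) :
    ∑ W : Finset V, g W =
      ∑ W ∈ Finset.univ.filter (fun W : Finset V => a₁ ∈ W), g W +
        ∑ W ∈ Finset.univ.filter (fun W : Finset V => a₁ ∉ W ∧ a₂ ∈ W), g W +
        ∑ W ∈ Finset.univ.filter (fun W : Finset V => a₁ ∉ W ∧ a₂ ∉ W), g W := by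
  rw [← Finset.sum_filter_add_sum_filter_not Finset.univ (fun W : Finset V => a₁ ∈ W) g,
    ← Finset.sum_filter_add_sum_filter_not (Finset.univ.filter (fun W : Finset V => a₁ ∉ W))
      (fun W : Finset V => a₂ ∈ W) g, Finset.filter_filter, Finset.filter_filter, add_assoc]

omit [LinearOrder R] [IsStrictOrderedRing R] [DecidablePred (· ∈ EA)] [DecidablePred (· ∈ EB)] in
/-- The class `{a₁ ∉ W, a₂ ∈ W}` sums to the event `Q ∩ Z ∩ {x ↮ a₁, x ↔ a₂}`. -/
lemma sum_F2 (Z : Set (Config E)) :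
    ∑ W ∈ Finset.univ.filter (fun W : Finset V => a₁ ∉ W ∧ a₂ ∈ W),
        prob p (fibre ends a₁ a₂ x W ∩ Z) =
      prob p (avoidAll ends a₂ {a₁} ∩ Z ∩ ((connEvent ends x a₁)ᶜ ∩ connEvent ends x a₂)) := by
  refine MarkPull.sum_filter_fibre_inter Z _ _ fun W ω hω => ?_
  rw [MarkPull.mem_iff_conn_of_mem_fibre hω a₁, MarkPull.mem_iff_conn_of_mem_fibre hω a₂]
  simp only [Set.mem_inter_iff, Set.mem_compl_iff]

omit [LinearOrder R] [IsStrictOrderedRing R] [DecidablePred (· ∈ EA)] [DecidablePred (· ∈ EB)] in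
/-- The class `{a₁ ∉ W, a₂ ∉ W}` sums to the event `Q ∩ Z ∩ {x ↮ a₁, x ↮ a₂}`. -/
lemma sum_F3 (Z : Set (Config E)) :
    ∑ W ∈ Finset.univ.filter (fun W : Finset V => a₁ ∉ W ∧ a₂ ∉ W),
        prob p (fibre ends a₁ a₂ x W ∩ Z) =
      prob p (avoidAll ends a₂ {a₁} ∩ Z ∩ ((connEvent ends x a₁)ᶜ ∩ (connEvent ends x a₂)ᶜ)) := by
  refine MarkPull.sum_filter_fibre_inter Z _ _ fun W ω hω => ?_
  rw [MarkPull.mem_iff_conn_of_mem_fibre hω a₁, MarkPull.mem_iff_conn_of_mem_fibre hω a₂]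
  simp only [Set.mem_inter_iff, Set.mem_compl_iff]

omit [Fintype V] [DecidablePred (· ∈ EB)] in
/-- On a fibre `W ∋ a₁`, `Sb F⁰_o / m_W − γ Sb = 0`. -/
lemma term_c1 (hp : IsProbVec p) (h : IsSep2 ends x a₁ ↑VA ↑VB EA EB) (ho : o ∈ VA) (h2 : a₂ ∈ VB)
    {W : Finset V} (ha1 : a₁ ∈ W) (γ : R) :
    Ssig p ends a₁ a₂ x b W * RootEdge.SFg p ends o a₁ a₂ x γ W / mW p ends a₁ a₂ x W -
      γ * Ssig p ends a₁ a₂ x b W = 0 := by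
  rw [SFg_c1 h ho h2 ha1 γ]
  by_cases hm : mW p ends a₁ a₂ x W = 0
  · have hf : prob p (fibre ends a₁ a₂ x W) = 0 := hm
    rw [hm, (Ssig_Su_eq b W).1, prob_fibre_inter_eq_zero hp ends a₁ a₂ x hf,
      prob_fibre_inter_eq_zero hp ends a₁ a₂ x hf]
    ring
  · rw [mul_div_assoc, mul_div_assoc, div_self hm]
    ring

/-- `∑_W (Sb F⁰_o(γ) / m_W − γ Sb) = 0` at `γ = gamma`. -/
lemma sum_term_sub (hp : IsProbVec p) (h : IsSep2 ends x a₁ ↑VA ↑VB EA EB) (ho : o ∈ VA)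
    (h2 : a₂ ∈ VB) (hb : b ∈ VB) (hD : prob p (PDEvent ends a₁ a₂ x) ≠ 0) :
    ∑ W : Finset V, (Ssig p ends a₁ a₂ x b W *
        RootEdge.SFg p ends o a₁ a₂ x (gamma p ends o a₁ a₂ x) W / mW p ends a₁ a₂ x W -
      gamma p ends o a₁ a₂ x * Ssig p ends a₁ a₂ x b W) = 0 := by
  set γ := gamma p ends o a₁ a₂ x with hγ
  have hb' : b ∈ (↑VB : Set V) ∪ {x, a₁} := Or.inl (Finset.mem_coe.2 hb)
  have ha1' : a₁ ∈ (↑VB : Set V) ∪ {x, a₁} := Or.inr (Or.inr rfl)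
  have ha2' : a₂ ∈ (↑VB : Set V) ∪ {x, a₁} := Or.inl (Finset.mem_coe.2 h2)
  have hx' : x ∈ (↑VB : Set V) ∪ {x, a₁} := Or.inr (Or.inl rfl)
  rw [sum_split]
  have e1 : ∑ W ∈ Finset.univ.filter (fun W : Finset V => a₁ ∈ W),
      (Ssig p ends a₁ a₂ x b W * RootEdge.SFg p ends o a₁ a₂ x γ W / mW p ends a₁ a₂ x W -
        γ * Ssig p ends a₁ a₂ x b W) = 0 :=
    Finset.sum_eq_zero fun W hW => term_c1 hp h ho h2 (Finset.mem_filter.1 hW).2 γ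
  have e2 : ∑ W ∈ Finset.univ.filter (fun W : Finset V => a₁ ∉ W ∧ a₂ ∈ W),
      (Ssig p ends a₁ a₂ x b W * RootEdge.SFg p ends o a₁ a₂ x γ W / mW p ends a₁ a₂ x W -
        γ * Ssig p ends a₁ a₂ x b W) =
      ∑ W ∈ Finset.univ.filter (fun W : Finset V => a₁ ∉ W ∧ a₂ ∈ W),
        (2 * (prob p (fibre ends a₁ a₂ x W ∩ (connEvent ends a₁ o ∩ connEvent ends a₁ b)) -
          γ * prob p (fibre ends a₁ a₂ x W ∩ connEvent ends a₁ b) -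
          prob p (fibre ends a₁ a₂ x W ∩ (connEvent ends a₁ o ∩ connEvent ends x b)) +
          γ * prob p (fibre ends a₁ a₂ x W ∩ connEvent ends x b))) :=
    Finset.sum_congr rfl fun W hW =>
      term_c2 hp h ho h2 hb (Finset.mem_filter.1 hW).2.1 (Finset.mem_filter.1 hW).2.2 γ
  have e3 : ∑ W ∈ Finset.univ.filter (fun W : Finset V => a₁ ∉ W ∧ a₂ ∉ W),
      (Ssig p ends a₁ a₂ x b W * RootEdge.SFg p ends o a₁ a₂ x γ W / mW p ends a₁ a₂ x W -
        γ * Ssig p ends a₁ a₂ x b W) =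
      ∑ W ∈ Finset.univ.filter (fun W : Finset V => a₁ ∉ W ∧ a₂ ∉ W),
        (prob p (fibre ends a₁ a₂ x W ∩ (connEvent ends a₁ o ∩ connEvent ends a₁ b)) -
          prob p (fibre ends a₁ a₂ x W ∩ (connEvent ends a₁ o ∩ connEvent ends a₂ b)) -
          γ * prob p (fibre ends a₁ a₂ x W ∩ connEvent ends a₁ b) +
          γ * prob p (fibre ends a₁ a₂ x W ∩ connEvent ends a₂ b)) :=
    Finset.sum_congr rfl fun W hW =>
      term_c3 hp h ho h2 hb (Finset.mem_filter.1 hW).2.1 (Finset.mem_filter.1 hW).2.2 γ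
  rw [e1, e2, e3]
  simp only [Finset.sum_add_distrib, Finset.sum_sub_distrib, ← Finset.mul_sum, sum_F2, sum_F3]
  rw [prob_G2_conn_o h ho h2 hD (bside_conn h ha1' hb'), prob_G2_conn_o h ho h2 hD (bside_conn h hx' hb'),
    prob_G3_conn_o h ho h2 hD (bside_conn h ha1' hb'), prob_G3_conn_o h ho h2 hD (bside_conn h ha2' hb')]
  ring

/-- **`∑_W Sb F⁰_o / m_W = γ ∑_W Sb`.** -/
lemma sum_term_eq (hp : IsProbVec p) (h : IsSep2 ends x a₁ ↑VA ↑VB EA EB) (ho : o ∈ VA)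
    (h2 : a₂ ∈ VB) (hb : b ∈ VB) (hD : prob p (PDEvent ends a₁ a₂ x) ≠ 0) :
    ∑ W : Finset V, Ssig p ends a₁ a₂ x b W *
        RootEdge.SFg p ends o a₁ a₂ x (gamma p ends o a₁ a₂ x) W / mW p ends a₁ a₂ x W =
      gamma p ends o a₁ a₂ x * ∑ W : Finset V, Ssig p ends a₁ a₂ x b W := by
  have key := sum_term_sub hp h ho h2 hb hD
  rw [Finset.sum_sub_distrib, ← Finset.mul_sum, sub_eq_zero] at key
  exact key

omit [LinearOrder R] [IsStrictOrderedRing R] in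
/-- `∑_W (F⁰_o(γ) − γ m_W) = 0` at `γ = gamma`. -/
lemma sum_SFg_sub (h : IsSep2 ends x a₁ ↑VA ↑VB EA EB) (ho : o ∈ VA) (h2 : a₂ ∈ VB)
    (hD : prob p (PDEvent ends a₁ a₂ x) ≠ 0) :
    ∑ W : Finset V, (RootEdge.SFg p ends o a₁ a₂ x (gamma p ends o a₁ a₂ x) W -
      gamma p ends o a₁ a₂ x * mW p ends a₁ a₂ x W) = 0 := by
  set γ := gamma p ends o a₁ a₂ x with hγ
  rw [sum_split]
  have e1 : ∑ W ∈ Finset.univ.filter (fun W : Finset V => a₁ ∈ W),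
      (RootEdge.SFg p ends o a₁ a₂ x γ W - γ * mW p ends a₁ a₂ x W) = 0 :=
    Finset.sum_eq_zero fun W hW => by rw [SFg_c1 h ho h2 (Finset.mem_filter.1 hW).2 γ, sub_self]
  have e2 : ∑ W ∈ Finset.univ.filter (fun W : Finset V => a₁ ∉ W ∧ a₂ ∈ W),
      (RootEdge.SFg p ends o a₁ a₂ x γ W - γ * mW p ends a₁ a₂ x W) =
      ∑ W ∈ Finset.univ.filter (fun W : Finset V => a₁ ∉ W ∧ a₂ ∈ W),
        (2 * (prob p (fibre ends a₁ a₂ x W ∩ (connEvent ends a₁ o ∩ Set.univ)) -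
          γ * prob p (fibre ends a₁ a₂ x W ∩ Set.univ))) :=
    Finset.sum_congr rfl fun W hW => by
      rw [MarkPull.SFg_of_mem_a2 o γ (Finset.mem_filter.1 hW).2.2, Set.inter_univ, Set.inter_univ]
      unfold mW
      ring
  have e3 : ∑ W ∈ Finset.univ.filter (fun W : Finset V => a₁ ∉ W ∧ a₂ ∉ W),
      (RootEdge.SFg p ends o a₁ a₂ x γ W - γ * mW p ends a₁ a₂ x W) =
      ∑ W ∈ Finset.univ.filter (fun W : Finset V => a₁ ∉ W ∧ a₂ ∉ W),
        (prob p (fibre ends a₁ a₂ x W ∩ (connEvent ends a₁ o ∩ Set.univ)) -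
          γ * prob p (fibre ends a₁ a₂ x W ∩ Set.univ)) :=
    Finset.sum_congr rfl fun W hW => by
      rw [SFg_c3 h ho h2 (Finset.mem_filter.1 hW).2.1 (Finset.mem_filter.1 hW).2.2 γ, Set.inter_univ,
        Set.inter_univ]
      rfl
  rw [e1, e2, e3]
  simp only [Finset.sum_sub_distrib, ← Finset.mul_sum, sum_F2, sum_F3]
  rw [prob_G2_conn_o h ho h2 hD bside_univ, prob_G3_conn_o h ho h2 hD bside_univ]
  ring

omit [LinearOrder R] [IsStrictOrderedRing R] in
/-- **`∑_W F⁰_o = γ P(Q)`.** -/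
lemma sum_SFg_eq (h : IsSep2 ends x a₁ ↑VA ↑VB EA EB) (ho : o ∈ VA) (h2 : a₂ ∈ VB)
    (hD : prob p (PDEvent ends a₁ a₂ x) ≠ 0) :
    ∑ W : Finset V, RootEdge.SFg p ends o a₁ a₂ x (gamma p ends o a₁ a₂ x) W =
      gamma p ends o a₁ a₂ x * prob p (avoidAll ends a₂ {a₁}) := by
  have key := sum_SFg_sub h ho h2 hD
  rw [Finset.sum_sub_distrib, ← Finset.mul_sum, sum_mW, sub_eq_zero] at key
  exact key

/-- **`∑_A Sub Suo / m_W = γ ∑_A Sub`.** -/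
lemma sum_termA_eq (hp : IsProbVec p) (h : IsSep2 ends x a₁ ↑VA ↑VB EA EB) (ho : o ∈ VA)
    (h2 : a₂ ∈ VB) (hb : b ∈ VB) (hD : prob p (PDEvent ends a₁ a₂ x) ≠ 0) :
    ∑ W ∈ fibresA a₁ a₂, Su p ends a₁ a₂ x b W * Su p ends a₁ a₂ x o W / mW p ends a₁ a₂ x W =
      gamma p ends o a₁ a₂ x * ∑ W ∈ fibresA a₁ a₂, Su p ends a₁ a₂ x b W := by
  have hb' : b ∈ (↑VB : Set V) ∪ {x, a₁} := Or.inl (Finset.mem_coe.2 hb)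
  have ha1' : a₁ ∈ (↑VB : Set V) ∪ {x, a₁} := Or.inr (Or.inr rfl)
  have ha2' : a₂ ∈ (↑VB : Set V) ∪ {x, a₁} := Or.inl (Finset.mem_coe.2 h2)
  have e1 : ∑ W ∈ fibresA a₁ a₂, Su p ends a₁ a₂ x b W * Su p ends a₁ a₂ x o W /
      mW p ends a₁ a₂ x W =
      ∑ W ∈ Finset.univ.filter (fun W : Finset V => a₁ ∉ W ∧ a₂ ∉ W),
        (prob p (fibre ends a₁ a₂ x W ∩ (connEvent ends a₁ o ∩ connEvent ends a₁ b)) +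
          prob p (fibre ends a₁ a₂ x W ∩ (connEvent ends a₁ o ∩ connEvent ends a₂ b))) :=
    Finset.sum_congr rfl fun W hW =>
      termA_c3 hp h ho h2 hb (Finset.mem_filter.1 hW).2.1 (Finset.mem_filter.1 hW).2.2
  have e2 : ∑ W ∈ fibresA a₁ a₂, Su p ends a₁ a₂ x b W =
      ∑ W ∈ Finset.univ.filter (fun W : Finset V => a₁ ∉ W ∧ a₂ ∉ W),
        (prob p (fibre ends a₁ a₂ x W ∩ connEvent ends a₁ b) +
          prob p (fibre ends a₁ a₂ x W ∩ connEvent ends a₂ b)) :=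
    Finset.sum_congr rfl fun W _ => (Ssig_Su_eq b W).2
  rw [e1, e2]
  simp only [Finset.sum_add_distrib, sum_F3]
  rw [prob_G3_conn_o h ho h2 hD (bside_conn h ha1' hb'), prob_G3_conn_o h ho h2 hD (bside_conn h ha2' hb')]
  ring

omit [LinearOrder R] [IsStrictOrderedRing R] [DecidablePred (· ∈ EA)] [DecidablePred (· ∈ EB)] in
/-- `∑_A Suo = γ D`. -/
lemma sum_SuA_o_eq (hD : prob p (PDEvent ends a₁ a₂ x) ≠ 0) :
    ∑ W ∈ fibresA a₁ a₂, Su p ends a₁ a₂ x o W =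
      gamma p ends o a₁ a₂ x * prob p (PDEvent ends a₁ a₂ x) := by
  rw [← Do_eq_fibresA]
  unfold gamma
  rw [div_mul_cancel₀ _ hD]

omit [Fintype V] [DecidableEq V] [DecidablePred (· ∈ EA)] [DecidablePred (· ∈ EB)] in
/-- `P(Q) ≠ 0` when `D ≠ 0`. -/
lemma prob_Q_ne_zero (hp : IsProbVec p) (hD : prob p (PDEvent ends a₁ a₂ x) ≠ 0) :
    prob p (avoidAll ends a₂ {a₁}) ≠ 0 := by
  intro h0
  apply hD
  have key : prob p (PDEvent ends a₁ a₂ x) ≤ prob p (avoidAll ends a₂ {a₁}) := by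
    refine prob_mono hp fun ω hω => ?_
    rw [mem_avoidAll]
    intro t ht
    rw [Finset.mem_singleton] at ht
    rw [ht]
    exact fun hc => hω.1 (conn_symm hc)
  rw [h0] at key
  exact le_antisymm key (prob_nonneg hp _)

/-- **THE UNIFIED o-SHIELD**: `K = {x, a₁}` separating `o` from `{b, a₂}` gives `btw(x; o, b) = 0`
(for `D ≠ 0`). -/
theorem btw_sep2_o (hp : IsProbVec p) (h : IsSep2 ends x a₁ ↑VA ↑VB EA EB) (ho : o ∈ VA)
    (h2 : a₂ ∈ VB) (hb : b ∈ VB) (hD : prob p (PDEvent ends a₁ a₂ x) ≠ 0) :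
    btw p ends o a₁ a₂ x b = 0 := by
  have hQ := prob_Q_ne_zero hp hD
  rw [← RootEdge.btwg_gamma]
  unfold RootEdge.btwg
  rw [sum_term_eq hp h ho h2 hb hD, sum_SFg_eq h ho h2 hD, sum_termA_eq hp h ho h2 hb hD,
    sum_SuA_o_eq (o := o) hD]
  field_simp
  ring

/-- (MEANS-a₃) at `x` in the unified o-shield class, unconditionally. -/
theorem A3Between_sep2_o (hp : IsProbVec p) (h : IsSep2 ends x a₁ ↑VA ↑VB EA EB) (ho : o ∈ VA)
    (h2 : a₂ ∈ VB) (hb : b ∈ VB) : A3Between p ends o a₁ a₂ x b := by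
  by_cases hD : prob p (PDEvent ends a₁ a₂ x) = 0
  · exact RootEdge.A3Between_of_PD_null p hp o b hD
  · unfold A3Between
    rw [btw_sep2_o hp h ho h2 hb hD]

/-- (HCOV) at `x` in the unified o-shield class. -/
theorem HCov_sep2_o (hp : IsProbVec p) (h : IsSep2 ends x a₁ ↑VA ↑VB EA EB) (ho : o ∈ VA)
    (h2 : a₂ ∈ VB) (hb : b ∈ VB) : HCov p ends o a₁ a₂ x b :=
  HCov_of_a3Between hp ends o a₁ a₂ x b (A3Between_sep2_o hp h ho h2 hb)

end Sums

end Sep2Shield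

end A3Fibre

end CovForm

end Summit.Ventures.PercRepro2
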